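import Summits.Schanuel.Schanuel.Theses.RootDecomp1K

/-!
# RootDecomp1K — round-4 glue: `HyperLiouvilleSchanuel → FiniteOrderLiouvilleSchanuel → PolyDiophantineSchanuel → StrictDiophantineSchanuel`
(lens-6 gen 9, NODE «HyperCarving» = LiouvilleCarving round 4)

Port file for the D-0019 glue item of the RESPLIT of `StrictDiophantineSchanuel` (stmt-Schanuel-31078) into
`HyperLiouvilleSchanuel` (A₄ʰ), `FiniteOrderLiouvilleSchanuel` (A₄ᵈ) and the existing `PolyDiophantineSchanuel`
(B₃, stmt-Schanuel-31987, declared residual): two classical case splits, on «`z` is Liouville as a linear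
form» and on «`z` is hyper-Liouville as a linear form» (`∀ m, ∃ h ≠ 0, ‖Σ hᵢzᵢ‖ < exp(−(1 + Σ|hᵢ|)^m)`).
No transcendence input; nothing is defined here (H1: no `_local` copies, no vendored facts).

Typed under PATH A″ (writer-1 g6, 2026-08-30T13:38:36Z, rev 5–8): NO separate glue item — the live deciding theorem is
the FLAT four-binder `closes (hL : CoordLiouvilleSchanuel) (hH : HyperLiouvilleSchanuel) (hF : FiniteOrderLiouvilleSchanuel)
(hB : PolyDiophantineSchanuel) : Schanuel` (items 31077 / 33363 / 33364 / 31987); LinLiouvilleSchanuel 31986 and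
StrictDiophantineSchanuel 31078 are retained asides.  This file records the glue arrows and the EXACTNESS at the A₃ node
(`LinLiouvilleSchanuel ↔ HyperLiouvilleSchanuel ∧ FiniteOrderLiouvilleSchanuel`) over the LIVE route declarations;
`--supports stmt-Schanuel-31986`.  Port by census-1 gen 7 of HOME/decomp-schanuel-lens-6/g9/prover/RootDecomp1KHyperSplit.port.lean
(critic CLEARED FOR TYPING 13:33:07Z; pre-edit evidence glue_test.lean rc 0).  Nothing here proves Schanuel; rung 0.
-/

set_option linter.dupNamespace false

namespace Summit.Schanuel.Schanuel.Theorems.RootDecomp1KHyperSplit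

open Summit.Schanuel.Schanuel.Theses.RootDecomp1K (StrictDiophantineSchanuel CoordLiouvilleSchanuel
  LinLiouvilleSchanuel PolyDiophantineSchanuel StrictDiophantineSchanuelGlue HyperLiouvilleSchanuel
  FiniteOrderLiouvilleSchanuel closes)

/-- The A₃-level identity: the retained round-3 child `LinLiouvilleSchanuel` (stmt-Schanuel-31986) follows
from the two round-4 children (excluded middle on the hyper-Liouville-form predicate). -/
theorem linLiouvilleSchanuel_of_hyper_split (hH : HyperLiouvilleSchanuel)
    (hF : FiniteOrderLiouvilleSchanuel) : LinLiouvilleSchanuel := by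
  intro n z hz hL
  by_cases hyp : ∀ m : ℕ, ∃ h : Fin n → ℤ, h ≠ 0 ∧
      ‖∑ i, (h i : ℂ) * z i‖ < Real.exp (-((1 + ∑ i, (|h i| : ℝ)) ^ m))
  · exact hH n z hz hyp
  · exact hF n z hz hL hyp

/-- The round-4 glue `A₄ʰ → A₄ᵈ → B₃ → StrictDiophantineSchanuel`. -/
theorem strictDiophantineSchanuel_of_hyper_split (hH : HyperLiouvilleSchanuel)
    (hF : FiniteOrderLiouvilleSchanuel) (hB : PolyDiophantineSchanuel) : StrictDiophantineSchanuel := by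
  intro n z hz hD
  by_cases hL : ∀ ω : ℕ, ∃ h : Fin n → ℤ, h ≠ 0 ∧ ‖∑ i, (h i : ℂ) * z i‖ < 1 / (1 + ∑ i, (|h i| : ℝ)) ^ ω
  · exact linLiouvilleSchanuel_of_hyper_split hH hF n z hz hL
  · exact hB n z hz hD hL

/-- Exactness at the A₃ node: `LinLiouvilleSchanuel ↔ HyperLiouvilleSchanuel ∧ FiniteOrderLiouvilleSchanuel`. -/
theorem linLiouvilleSchanuel_iff_hyper_split :
    LinLiouvilleSchanuel ↔ HyperLiouvilleSchanuel ∧ FiniteOrderLiouvilleSchanuel := by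
  refine ⟨fun h => ⟨fun n z hz hyp => h n z hz fun ω => ?_, fun n z hz hL _ => h n z hz hL⟩,
    fun h => linLiouvilleSchanuel_of_hyper_split h.1 h.2⟩
  obtain ⟨g, hg0, hg⟩ := hyp ω
  refine ⟨g, hg0, hg.trans_le ?_⟩
  have hS : (0 : ℝ) < 1 + ∑ i, (|g i| : ℝ) := by positivity
  have hx : (0 : ℝ) < (1 + ∑ i, (|g i| : ℝ)) ^ ω := pow_pos hS ω
  calc Real.exp (-((1 + ∑ i, (|g i| : ℝ)) ^ ω)) ≤ 1 / (1 + (1 + ∑ i, (|g i| : ℝ)) ^ ω) := by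
        rw [Real.exp_neg, one_div]
        exact inv_anti₀ (by positivity) (by linarith [Real.add_one_le_exp ((1 + ∑ i, (|g i| : ℝ)) ^ ω)])
    _ ≤ 1 / (1 + ∑ i, (|g i| : ℝ)) ^ ω := by
        apply one_div_le_one_div_of_le hx; linarith

/-- The live route's deciding theorem fed by the round-4 pieces (= `closes`, recorded for the A₃-level bookkeeping). -/
theorem schanuel_of_pieces₄ (hL : CoordLiouvilleSchanuel) (hH : HyperLiouvilleSchanuel)
    (hF : FiniteOrderLiouvilleSchanuel) (hB : PolyDiophantineSchanuel) : _root_.Schanuel :=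
  closes hL hH hF hB

/-- … and through the round-3 cone: `S_L′ ∧ StrictDiophantineSchanuel ⟹ Schanuel` with S_D′ assembled from the
round-4 pieces (the rev-4 two-binder deciding theorem, re-proved over the live declarations). -/
theorem schanuel_of_coord_strict (hL : CoordLiouvilleSchanuel) (hD : StrictDiophantineSchanuel) : _root_.Schanuel := by
  intro n z hz
  by_cases h : ∃ w ∈ Submodule.span ℚ (Set.range z), Liouville w.re ∨ Liouville w.im
  · exact hL n z hz h
  · exact hD n z hz h

end Summit.Schanuel.Schanuel.Theorems.RootDecomp1KHyperSplit
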